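import Mathlib
import Summits.ResolutionOfSingularities.ResolutionOfSingularities.Theorems.HomologicalConductorPersistenceKC3LocIsLocalization
import Summits.ResolutionOfSingularities.ResolutionOfSingularities.Theorems.HomologicalConductorPersistenceKC3WitnessBaseChange
import Summits.ResolutionOfSingularities.ResolutionOfSingularities.Theorems.HomologicalConductorPersistenceKC3FrobeniusOrder
import HarnessLib

/-!
# Crux `Persistence` (stmt-ResolutionOfSingularities-16484), K-C3 §H2L object K5, part β:
# SOCKET K4 OF THE K5 SKELETON — `x = a⁶ ∉ ca(T₁)`, `T₁ = loc O W`, MODULO THE PROJECTIVITY OF `X_b` OVER `P₀` (K4e)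

Route `ResolutionOfSingularities/HomologicalConductor`, chain W4.4b (CHAIN v13.9; K5 skeleton of record `kc3.lean`
426e18cfa946fb83, registered socket `stub_kc3_x_not_mem_ca_locW`; holder of record res-L1-w44b-lead-1). [OURS · L1 w44b]
AI-written, weaker than expert review; NOT a statement of the manuscript under study (Hironaka 2017) and no statement of it
is used; no theorem here concludes the crux.

ASSEMBLY (nothing new is proved about the witness): for ANY subalgebra `W ⊆ K'` identified with `W₀ = kc3W k` by
`e : W₀ ≃ₐ[k] W`, any valuation ring `O` of `K'` for which the elements of `W₀` with non-zero constant term are exactly the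
`O`-units of `W` (`hS`), and `loc O W` noetherian: IF the `W₀`-module `X_b` (res-D-pv-058 `KC3WitnessBaseChange.kc3Xb`) is
projective over `P₀ = k[a⁶,b³,c²]` (K4e, res-D-pv-058 — a HYPOTHESIS here), THEN `e(a⁶) ∉ ca (loc O W)`:
* `loc O W = W₀[S⁻¹]` (part α, `PersistenceKC3Loc.isLocalization_loc_of_algEquiv`, p538374);
* `a⁶` does not stably annihilate `(loc O W) ⊗_{W₀} X_b` (res-D-pv-058 K4c socket form
  `KC3WitnessBaseChange.not_stablyAnnihilates_baseChange`, hypothesis `hS` = part α `coeff_zero_ne_zero_of_mem_kc3S`);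
* hence `a⁶ ∉ ca(loc O W)` at every level (res-D-pv-037 K4d socket
  `KC3FrobeniusOrder.not_mem_cohomologyAnnihilator_of_kc3Lattice_isLocalization`: `W₀` is a free Frobenius `P₀`-order,
  `X_b` a `P₀`-projective `W₀`-lattice, all syzygies of lattices are lattices);
* last inch to the route's `NoZeno.Birth.ca` (part α `not_mem_ca_of_not_mem_cohomologyAnnihilator`).
Instantiated at the K-C3 datum (`K' = k(x,z,t)`, `O = O_w`, `W` the `x`-chart, `e` = res-D-pv-021's dictionary via part α
`exists_kc3_dictionary`, `e(a⁶) = x`): **`kc3_x_not_mem_ca_locW_of_projective [Module.Projective ↥(kc3P k) (kc3Xb k)] :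
x ∉ ca (loc O W)`** — socket K4 of `kc3.lean` modulo K4e, for EVERY field `k`.
References: `ca` vocabulary [cite: IyengarTakahashi2014, Definition 2.1].
-/

noncomputable section

-- single-problem summit: the doubled namespace component `ResolutionOfSingularities` is forced
set_option linter.dupNamespace false

open MvPolynomial
open scoped TensorProduct
open Literature.AlgebraicGeometry.Resolution.WeightedBlowup
open Summit.ResolutionOfSingularities.ResolutionOfSingularities.Theorems.NoZeno.Birth
open Summit.ResolutionOfSingularities.ResolutionOfSingularities.Theorems.HomologicalConductor.PersistenceMonomialValuation
open Summit.ResolutionOfSingularities.ResolutionOfSingularities.Theorems.HomologicalConductor.KC3FrobeniusOrder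
open Summit.ResolutionOfSingularities.ResolutionOfSingularities.Theorems.HomologicalConductor.KC3WitnessBaseChange
open Summit.ResolutionOfSingularities.ResolutionOfSingularities.Theorems.HomologicalConductor.PersistenceKC3Loc

namespace Summit.ResolutionOfSingularities.ResolutionOfSingularities.Theorems.HomologicalConductor.PersistenceKC3

variable (k : Type) [Field k]

/-- `K = k(x,z,t)`. -/
local notation3 "𝕂" => FractionRing (MvPolynomial (Fin 3) k)
/-- `ι : k[x,z,t] → K`. -/
local notation3 "ι" => algebraMap (MvPolynomial (Fin 3) k) (FractionRing (MvPolynomial (Fin 3) k))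
/-- `x`. -/
local notation3 "𝔵" => algebraMap (MvPolynomial (Fin 3) k) (FractionRing (MvPolynomial (Fin 3) k)) (MvPolynomial.X 0)
/-- `z`. -/
local notation3 "𝔷" => algebraMap (MvPolynomial (Fin 3) k) (FractionRing (MvPolynomial (Fin 3) k)) (MvPolynomial.X 1)
/-- `t`. -/
local notation3 "𝔱" => algebraMap (MvPolynomial (Fin 3) k) (FractionRing (MvPolynomial (Fin 3) k)) (MvPolynomial.X 2)
/-- `W = k[x, z, t, z²x⁻¹, ztx⁻¹, t²x⁻¹, z³x⁻¹x⁻¹] ⊆ k(x,z,t)` (spelling of `kc3_tower_one_eq`; local notation only). -/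
local notation3 "𝕎" => (Algebra.adjoin k
  ({algebraMap (MvPolynomial (Fin 3) k) (FractionRing (MvPolynomial (Fin 3) k)) (MvPolynomial.X 0),
    algebraMap (MvPolynomial (Fin 3) k) (FractionRing (MvPolynomial (Fin 3) k)) (MvPolynomial.X 1),
    algebraMap (MvPolynomial (Fin 3) k) (FractionRing (MvPolynomial (Fin 3) k)) (MvPolynomial.X 2),
    algebraMap (MvPolynomial (Fin 3) k) (FractionRing (MvPolynomial (Fin 3) k)) (MvPolynomial.X 1) ^ 2 *
      (algebraMap (MvPolynomial (Fin 3) k) (FractionRing (MvPolynomial (Fin 3) k)) (MvPolynomial.X 0))⁻¹,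
    algebraMap (MvPolynomial (Fin 3) k) (FractionRing (MvPolynomial (Fin 3) k)) (MvPolynomial.X 1) *
      algebraMap (MvPolynomial (Fin 3) k) (FractionRing (MvPolynomial (Fin 3) k)) (MvPolynomial.X 2) *
      (algebraMap (MvPolynomial (Fin 3) k) (FractionRing (MvPolynomial (Fin 3) k)) (MvPolynomial.X 0))⁻¹,
    algebraMap (MvPolynomial (Fin 3) k) (FractionRing (MvPolynomial (Fin 3) k)) (MvPolynomial.X 2) ^ 2 *
      (algebraMap (MvPolynomial (Fin 3) k) (FractionRing (MvPolynomial (Fin 3) k)) (MvPolynomial.X 0))⁻¹,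
    algebraMap (MvPolynomial (Fin 3) k) (FractionRing (MvPolynomial (Fin 3) k)) (MvPolynomial.X 1) ^ 3 *
      (algebraMap (MvPolynomial (Fin 3) k) (FractionRing (MvPolynomial (Fin 3) k)) (MvPolynomial.X 0))⁻¹ *
      (algebraMap (MvPolynomial (Fin 3) k) (FractionRing (MvPolynomial (Fin 3) k)) (MvPolynomial.X 0))⁻¹} :
    Set (FractionRing (MvPolynomial (Fin 3) k))) : Subalgebra k (FractionRing (MvPolynomial (Fin 3) k)))
/-- The `(6,5,4)`-monomial valuation ring `O ⊆ K` (res-type-084's K3a; local notation only). -/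
local notation3 "𝕆" => monomialValuationRing k (kc3Weight 1) (FractionRing (MvPolynomial (Fin 3) k))
/-- The dictionary substitution `θ₀ : x ↦ x⁶, z ↦ x⁴z, t ↦ x³t` (local notation only). -/
local notation3 "θ₀" => MvPolynomial.aeval (R := k) (S₁ := MvPolynomial (Fin 3) k)
  (![MvPolynomial.X 0 ^ 6, MvPolynomial.X 0 ^ 4 * MvPolynomial.X 1, MvPolynomial.X 0 ^ 3 * MvPolynomial.X 2] :
    Fin 3 → MvPolynomial (Fin 3) k)

/-! ## §1 Generic assembly: `e(a⁶) ∉ ca (loc O W)` for any realisation `e : W₀ ≃ W ⊆ K'` -/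

/-- **K4 assembled, generically in the realisation.** For `e : W₀ ≃ₐ[k] W ⊆ K'`, `O` a valuation ring of `K'` whose
units in `W` are the images of the elements of `W₀` with non-zero constant term, `loc O W` noetherian, and `X_b` projective
over `P₀`: `e(a⁶) ∉ ca (loc O W)`. [OURS · L1 w44b · K-C3 K5β] -/
theorem not_mem_ca_loc_of_kc3Lattice {K' : Type} [Field K'] [Algebra k K'] (O : ValuationSubring K') (W : Subalgebra k K')
    (e : ↥(kc3W k) ≃ₐ[k] ↥W) (hWloc : W ≤ loc O W)
    (hS : ∀ s : ↥(kc3W k), s ∈ (IsUnit.submonoid k).comap (((MvPolynomial.constantCoeff : MvPolynomial (Fin 3) k →+* k).comp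
      (Subalgebra.val (kc3W k)).toRingHom).toMonoidHom) ↔ ((e s : K') ≠ 0 ∧ ((e s : K'))⁻¹ ∈ O))
    [IsNoetherianRing ↥(loc O W)] [Module.Projective ↥(kc3P k) (kc3Xb k)] :
    ((e (kc3x k) : ↥W) : K') ∉ NoZeno.Birth.ca (loc O W) := by
  letI := ((Subalgebra.inclusion hWloc).toRingHom.comp e.toAlgHom.toRingHom).toAlgebra
  haveI := isLocalization_loc_of_algEquiv (k := k) O W e _ hWloc hS
  have hx := not_stablyAnnihilates_baseChange k ↥(loc O W)
    ((IsUnit.submonoid k).comap (((MvPolynomial.constantCoeff : MvPolynomial (Fin 3) k →+* k).comp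
      (Subalgebra.val (kc3W k)).toRingHom).toMonoidHom)) (fun s hs => coeff_zero_ne_zero_of_mem_kc3S s hs)
  have h := not_mem_cohomologyAnnihilator_of_kc3Lattice_isLocalization (kc3Xb k) ↥(loc O W)
    ((IsUnit.submonoid k).comap (((MvPolynomial.constantCoeff : MvPolynomial (Fin 3) k →+* k).comp
      (Subalgebra.val (kc3W k)).toRingHom).toMonoidHom)) hx
  exact not_mem_ca_of_not_mem_cohomologyAnnihilator (k := k) (loc O W) (hWloc (e (kc3x k)).2) h

/-! ## §2 The K-C3 datum: socket K4 of `kc3.lean` modulo K4e -/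

/-- **SOCKET K4 of the K5 skeleton modulo K4e**: at the K-C3 datum (`K = k(x,z,t)`, `O = O_w`, `W` the `x`-chart), if
`X_b` is projective over `P₀` then `x ∉ ca (loc O W)` — for EVERY field `k`. [OURS · L1 w44b · K-C3 K5β] -/
theorem kc3_x_not_mem_ca_locW_of_projective [Module.Projective ↥(kc3P k) (kc3Xb k)] :
    (𝔵 : 𝕂) ∉ NoZeno.Birth.ca (loc 𝕆 𝕎) := by
  obtain ⟨e, θ, hθι, hθe, hex⟩ := exists_kc3_dictionary (k := k)
  haveI := isNoetherianRing_loc_W (k := k)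
  have h := not_mem_ca_loc_of_kc3Lattice k 𝕆 𝕎 e W_le_loc (mem_kc3S_iff_unit e θ hθι hθe)
  have hval : ((e (kc3x k) : ↥𝕎) : 𝕂) = 𝔵 := hex
  rwa [hval] at h

end Summit.ResolutionOfSingularities.ResolutionOfSingularities.Theorems.HomologicalConductor.PersistenceKC3

end
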